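import Literature.MathematicalPhysics.QuantumFieldTheory.Balaban1983to89.B16NodeKnitTowerDatum
import Literature.MathematicalPhysics.QuantumFieldTheory.Balaban1983to89.Node00.RepTowerOfRecord

/-!
# `Balaban1983to89.B16NodeKnitRepTowerOfRecord` — YM-DAG node N13 · [Balaban1989LargeFieldII] CMP **122** (1989) 355–392, Theorem 1 p. 355 + (0.1),
# Cor. 3 pp. 387 ∕ 391: the N13 knit AT THE REPRESENTED TOWER OF RECORD — a world bound to a machine core's construction OVER THE DENSITIES OF RECORD
# `ρ_k := Node00.rhoOfRecord9 …` (node00-def-T's FILE 2 `Node00/RepTowerOfRecord`, p417991: `ρ_k = eval rep_k`, the slot family `slotsOfRecord` built by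
# `slot_{k+1} = rstepSlotOfRecord (tstepOfRecord slot_k)`), PROVISO-FREE (no tower obligation is read — only `w.C`); §0 the same over a machine core's
# construction over ANY density family (the Stage-₉ datum `datumOfTower F N M τ` of module 12 is the instance `ρ := τ.ρ`, `rfl`)

statement-level bookkeeping over published theorems with citation tags; kernel-checked compositions of tree theorems;
nothing here is a claim about the Yang–Mills mass gap.

CITATION HEADER (lean-in-tree rule).  Source: T. Bałaban, *Large field renormalization. II. Localization, exponentiation, and bounds for the
𝐑 operation*, Commun. Math. Phys. **122**, 355–392 (1989), doi:10.1007/bf01238433 [Balaban1989LargeFieldII] (cell paper B16 = «[V]»), with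
[Balaban1988Convergent] («[III]» CMP 119: the assumed 𝐑 of p. 244, (2.18) p. 257, Thm 1 p. 262, Cor. 3 (2.50) p. 264, (3.1) p. 264, (3.24)–(3.25) p. 270) and
[Balaban1989LargeFieldI] («[IV]» CMP 122: (0.2)–(0.4) p. 176).  Seat `pub-ymgap-dag-n13-a` (YM-PLAN Track A, HUMAN RULING D-0062: the KNIT-BY-NAME seat of
node N13; chair R437 ∕ R439 ∕ R446), module 13 of the seat.  BY NAME and UNCHANGED: `…Node00.RepTowerOfRecord` (seat node00-def-T: `slotsOfRecord`,
`slotsTOfRecord`, `rhoOfRecord9`, `slotsOfRecord_succ`, `slotsTOfRecord_succ` — both `rfl`), `…Node00.TStepOfRecord` (`tstepOfRecord`, `StepWeightsOfRecord`),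
`…Node00.RStepSlotOfRecord` (seat node00-def-R: `rstepSlotOfRecord`, `TexpASlot`, `TowerNumerics`, `PpSelOfRecord`), `…Node00.LargeFieldReprOfRecord`
(`densityOfRepr`, `SeqOfRecord`, `chiSeqOfRecord`), `…T4DatumAssemblyTower` (seat dag-n23-a: `RGMachineCore`, `RGMachineCore.construction`, `construction_ρ ∕ _g ∕
_sect2Form`), `…B16NodeKnitRepTower` (module 8: `rOperation_of_repTower`), `…B16NodeKnitRecord5` (module 5: `b16_main_of_rOperation_of_uvSlot`), `…B16`
(`UVIneq`, `uvIneq_of_le`), `…B14Cor3` (`inInterval_of_le`), `…DagBinding` (`leavesP`, `WorldP`), `…Dag` (`B16_main` :253).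

WHY THIS FILE (node00-def-T [INTENT-3] `Record9`: `datumOfRecord₉ θ h := datumOfTower F N (coreOfRecord₉ θ) (towerOfRecord₉ θ h)` with `dens = densOfRecord₉ θ =
rhoOfRecord9 …` EXPLICIT; seat dag-n11-a's sibling `B14NodeKnitRecord9`; chair R446 (A) (R-C2) MASS∕SUPPORT rider).  At NODE 00's Stage ₉ the construction a binding
world carries is a machine core's construction over THE DENSITIES OF RECORD `ρ_k = rhoOfRecord9 F N ν τ E w ppSel p (g p) k = densityOfRepr … (slotsOfRecord …) p (g p) k`
— explicit functions of the gauge field, assembled from the slot family of record, which obeys node00-def-T's recursion BY `rfl`.  N13's knit reads ONLY `w.C`: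
it needs no tower OBLIGATION (`isRT_Trho`, (0.4)) and hence none of the displayed provisos of the (0.3) chain (so the (R-C2) vacuity class does not bear on
it) — which is why this module is phrased over `w.C = M.construction ρ` for an ARBITRARY density family `ρ` (§0) and then AT `ρ := rhoOfRecord9 …` (§1), where
the recursion hypothesis `hsucc` DISAPPEARS (`slotsOfRecord_succ ▸ slotsTOfRecord_succ`, `rfl`) and the Stage-₉ reading is «`M.Sect2Form P k ↔ Laws k (slot_k)`».
What remains displayed is exactly N13's two products at the objects of record: (R₉) THE R-STEP OF RECORD `rstepSlotOfRecord` carries level-`(k+1)` slots obeying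
`LawsT k` into slots obeying `Laws (k+1)` ([Balaban1989LargeFieldII] Thm 1 for 𝐑), read into the world's 𝐑-leaf by the pin reading `hRpin`; (UV₉) (0.1) POINTWISE
ON `rhoOfRecord9 … k U` for law-abiding slots below the threshold (p. 387) — with `Laws ∕ LawsT` the §2-format laws NODE 00 pins next (`S218OfRecord₉`,
`TermTowerOfRecord`; today parameters).

WHAT THIS FILE PROVES (0 `sorry`, 0 `def`, standard axioms).
§0 over `w.C = M.construction ρ`, any density family `ρ`: `smallCouplings_iff_genFlow_construction`, **`uvBounds_iff_construction`** ((0.1) pointwise ON `ρ P k`),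
   `uvBounds_iff_eval_construction`, `uvSlot_at_construction` ∕ `_dominated`, **`b16_main_at_construction_repTower`** ∕ `_along` ∕ `_dominated`,
   `uvIneq_eval_of_b16_main_at_construction` (A4 locator).  (Module 12's tower datum is the instance `ρ := τ.ρ`: `(datumOfTower F N M τ).C = M.construction τ.ρ`, `rfl`.)
§1 AT THE REPRESENTED TOWER OF RECORD `ρ := fun p k => rhoOfRecord9 F N ν τ E sw ppSel p (g p) k`: **`uvBounds_iff_rhoOfRecord9`** (N13's conclusion IS (0.1)
   pointwise on the densities of record), `slotsOfRecord_recursion` (the recursion in module-12 letters, `rfl`), **`b16_main_at_repTowerOfRecord`** ((R₉) on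
   `rstepSlotOfRecord` + pin reading + «`Sect2Form ↔ Laws (slot)`» + (UV₉) on `rhoOfRecord9`; NO `hsucc`, NO `hρ`), `b16_main_at_repTowerOfRecord_along`,
   `b16_main_at_repTowerOfRecord_dominated` (from DOMINATED per-step constants with `B16.UVIneq (M.construction ρ P) k U E₋ E₊` — the Cor.-3 chain's currency —
   given `M.χ ≥ 0`), `uvIneq_rhoOfRecord9_of_b16_main` (A4: what N13's Cor.-3 product SAYS at the tower of record).
§2 (v1.1) **`b16_main_forall_of_recordShape`** ∕ `_along` — N13 at every run of every world of ANY record predicate of node00-def-T's Stage-₉ SHAPE ([INTENT-3] §6: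
   `(Θ, Prov, Adm, νOf, τOf, EOf, swOf, ppOf, gOf, core, datum, Rec)` with `(datum θ h).C = (core θ).construction (ρ₉ θ)`), so that the `Record9` corollary is a `rfl`
   instantiation (seat dag-n11-a's `b14_main_forall_of_recordShape` pattern).

HONEST FRAMING.  A count-neutral SLOT landing (R429 (4)(i)): N13 is NOT discharged — (R₉) for the R-step of record and (UV₉) on the densities of record are
displayed HYPOTHESES (what [Balaban1989LargeFieldII] proves, pp. 356–391 and p. 387); the machine core, the laws `Laws ∕ LawsT`, the residual step data `E, sw,
ppSel, g` and the pin reading are parameters ∕ NODE 00's; nothing of Bałaban's asserted or proved here; no tower obligation or (0.3)-chain proviso is consumed.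
One finite four-torus programme at fixed `ε`, Bałaban AS PRINTED with locators; nothing continuum ∕ ℝ⁴ ∕ OS ∕ mass gap ∕ Clay.
-/

noncomputable section

open MeasureTheory
open scoped BigOperators

namespace Literature.MathematicalPhysics.QuantumFieldTheory.Balaban1983to89.B16NodeKnitRepTowerOfRecord

open DagBinding T4DatumAssembly T4Continuum Node00 FlowStepRuns
open B16NodeKnitRecord5 (b16_main_of_rOperation_of_uvSlot)
open B16NodeKnitRepTower (rOperation_of_repTower)

variable (F : T4Family) (N : ℕ) [NeZero N]

/-! ## §0. N13 at a machine core's construction over ANY density family `ρ` (`w.C = M.construction ρ`) -/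

section Construction

variable (M : RGMachineCore F (SU N)) (ρ : (p : B12.RunParams) → (k : ℕ) → Density (F.P p.K) k (SU N)) (w : WorldP) (P : B12.RunParams)

/-- At a world on the construction the interval hypothesis of the run `P` reads the forward-generated flow `genFlow M.βfun P.g0` on `]0, w.γ]`
(`construction_flow`, `rfl`). [cite: Balaban1987RG1, (0.17)–(0.20) pp.255–256 (bookkeeping)] -/
theorem smallCouplings_iff_genFlow_construction (hC : w.C = M.construction ρ) :
    (leavesP w P).smallCouplings ↔ (genFlow M.βfun P.g0).InInterval w.γ P.K := by
  show (w.C P).flow.InInterval w.γ P.K ↔ _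
  rw [hC]
  exact Iff.rfl

/-- **N13's CONCLUSION `uvBounds` AT A WORLD ON THE CONSTRUCTION, UNFOLDED**: (0.1) ∕ (2.50) [III] ON THE FUNCTIONS `ρ P k` at the core's characteristic functions,
background Wilson actions, forward-generated couplings and the site count of `T₁^{(k)}` (`rfl`: `construction_ρ ∕ _g`, the core's `χ`, `wilsonBG`, `numSites`).
[cite: Balaban1989LargeFieldII, (0.1) pp.355–356; Balaban1988Convergent, Cor. 3 (2.50) p.264] -/
theorem uvBounds_iff_construction (hC : w.C = M.construction ρ) :
    (leavesP w P).uvBounds ↔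
      ∀ k, k ≤ P.K → ∀ U : GaugeField (F.P P.K) k (SU N),
        M.χ P k U * Real.exp (-(1 / (genSeq M.βfun P.g0 k) ^ 2 * M.wilsonBG P k U)
            - w.em (genSeq M.βfun P.g0 k) * (Fintype.card (Site (F.P P.K) k) : ℝ)) ≤ ρ P k U ∧
        ρ P k U ≤ Real.exp (w.ep (genSeq M.βfun P.g0 k) * (Fintype.card (Site (F.P P.K) k) : ℝ)) := by
  show (∀ k, k ≤ P.K → ∀ U : (w.C P).Cfg k,
    B16.UVIneq (w.C P) k U (w.em ((w.C P).flow.g k)) (w.ep ((w.C P).flow.g k))) ↔ _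
  rw [hC]
  exact Iff.rfl

variable {Rep : ℕ → Type*} (rep : (k : ℕ) → Rep k) (Tstep : (k : ℕ) → Rep k → Rep (k + 1))
  (Rstep : (k : ℕ) → Rep (k + 1) → Rep (k + 1)) (Laws : (k : ℕ) → Rep k → Prop) (LawsT : (k : ℕ) → Rep (k + 1) → Prop)
  (eval : (k : ℕ) → Rep k → Density (F.P P.K) k (SU N))

/-- … hence ON REPRESENTED FUNCTIONS: with `ρ P k = eval rep_k` (`hρ`) N13's conclusion at `(w, P)` IS (0.1) on `eval rep_k`, pointwise.
[cite: Balaban1989LargeFieldII, (0.1) pp.355–356; Balaban1988Convergent, (2.18) p.257] -/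
theorem uvBounds_iff_eval_construction (hC : w.C = M.construction ρ) (hρ : ∀ k, ρ P k = eval k (rep k)) :
    (leavesP w P).uvBounds ↔
      ∀ k, k ≤ P.K → ∀ U : GaugeField (F.P P.K) k (SU N),
        M.χ P k U * Real.exp (-(1 / (genSeq M.βfun P.g0 k) ^ 2 * M.wilsonBG P k U)
            - w.em (genSeq M.βfun P.g0 k) * (Fintype.card (Site (F.P P.K) k) : ℝ)) ≤ eval k (rep k) U ∧
        eval k (rep k) U ≤ Real.exp (w.ep (genSeq M.βfun P.g0 k) * (Fintype.card (Site (F.P P.K) k) : ℝ)) := by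
  rw [uvBounds_iff_construction F N M ρ w P hC]
  refine forall₂_congr fun k _ => forall_congr' fun U => ?_
  rw [hρ k]

/-- **N13's Cor.-3 slot AT A WORLD ON THE CONSTRUCTION from (UV₉)**: below the threshold `γ₁ ≥ w.γ`, every law-abiding level (`hSL`: the core's clause yields the laws)
satisfies (0.1) on `eval rep_k` pointwise (`hUV9`) ⇒ «(interval ⇒ §2 description) ⇒ (interval ⇒ `uvBounds`)» at `(w, P)`.
[cite: Balaban1989LargeFieldII, (0.1) pp.355–356, p.387; Balaban1988Convergent, Cor. 3 (2.50) p.264] -/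
theorem uvSlot_at_construction (hC : w.C = M.construction ρ) (hρ : ∀ k, ρ P k = eval k (rep k))
    (hSL : ∀ k, k ≤ P.K → M.Sect2Form P k → Laws k (rep k)) {γ₁ : ℝ} (hγ : w.γ ≤ γ₁)
    (hUV9 : (genFlow M.βfun P.g0).InInterval γ₁ P.K → ∀ k, k ≤ P.K → Laws k (rep k) → ∀ U : GaugeField (F.P P.K) k (SU N),
      M.χ P k U * Real.exp (-(1 / (genSeq M.βfun P.g0 k) ^ 2 * M.wilsonBG P k U)
          - w.em (genSeq M.βfun P.g0 k) * (Fintype.card (Site (F.P P.K) k) : ℝ)) ≤ eval k (rep k) U ∧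
      eval k (rep k) U ≤ Real.exp (w.ep (genSeq M.βfun P.g0 k) * (Fintype.card (Site (F.P P.K) k) : ℝ))) :
    ((leavesP w P).smallCouplings → (leavesP w P).densitiesDescribed) →
      ((leavesP w P).smallCouplings → (leavesP w P).uvBounds) := by
  intro hdd hsc
  have hs : ∀ k, k ≤ P.K → M.Sect2Form P k := by
    have h := hdd hsc
    change ∀ k, k ≤ P.K → (w.C P).Sect2Form k at h
    rw [hC] at h
    exact h
  have hin : (genFlow M.βfun P.g0).InInterval γ₁ P.K :=
    B14Cor3.inInterval_of_le ((smallCouplings_iff_genFlow_construction F N M ρ w P hC).1 hsc) hγ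
  rw [uvBounds_iff_eval_construction F N M ρ w P rep eval hC hρ]
  exact fun k hk U => hUV9 hin k hk (hSL k hk (hs k hk)) U

/-- **N13's Cor.-3 slot AT A WORLD ON THE CONSTRUCTION from DOMINATED per-step constants** `E₋ ≤ w.em(g_k)`, `E₊ ≤ w.ep(g_k)` with `B16.UVIneq (M.construction ρ P) k U E₋ E₊`
pointwise (the Cor.-3 chain's output currency), given `M.χ ≥ 0` (`B16.uvIneq_of_le`). [cite: Balaban1989LargeFieldII, (0.1) pp.355–356, p.387] -/
theorem uvSlot_at_construction_dominated (hC : w.C = M.construction ρ)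
    (hSL : ∀ k, k ≤ P.K → M.Sect2Form P k → Laws k (rep k)) {γ₁ : ℝ} (hγ : w.γ ≤ γ₁)
    (hχ : ∀ k, k ≤ P.K → ∀ U : GaugeField (F.P P.K) k (SU N), 0 ≤ M.χ P k U)
    (hUVd : (genFlow M.βfun P.g0).InInterval γ₁ P.K → ∀ k, k ≤ P.K → Laws k (rep k) →
      ∃ Em Ep : ℝ, Em ≤ w.em (genSeq M.βfun P.g0 k) ∧ Ep ≤ w.ep (genSeq M.βfun P.g0 k) ∧
        ∀ U : GaugeField (F.P P.K) k (SU N), B16.UVIneq (M.construction ρ P) k U Em Ep) :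
    ((leavesP w P).smallCouplings → (leavesP w P).densitiesDescribed) →
      ((leavesP w P).smallCouplings → (leavesP w P).uvBounds) := by
  intro hdd hsc
  have hs : ∀ k, k ≤ P.K → M.Sect2Form P k := by
    have h := hdd hsc
    change ∀ k, k ≤ P.K → (w.C P).Sect2Form k at h
    rw [hC] at h
    exact h
  have hin : (genFlow M.βfun P.g0).InInterval γ₁ P.K :=
    B14Cor3.inInterval_of_le ((smallCouplings_iff_genFlow_construction F N M ρ w P hC).1 hsc) hγ
  rw [uvBounds_iff_construction F N M ρ w P hC]
  intro k hk U
  obtain ⟨Em, Ep, hm, hp, h⟩ := hUVd hin k hk (hSL k hk (hs k hk))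
  exact B16.uvIneq_of_le (M.construction ρ P) k U (hχ k hk U) (h U) hm hp

/-- **N13 AT A WORLD ON THE CONSTRUCTION OVER A REPRESENTED DENSITY FAMILY** ([Balaban1989LargeFieldII] Thm 1 p. 355 + (0.1), Cor. 3 pp. 387 ∕ 391): representation data
with the recursion `rep (k+1) = Rstep k (Tstep k (rep k))` (`hsucc`), `ρ P k = eval rep_k` (`hρ`), the core's clause «form ∧ laws» (`hS9`); N13 from (R₉) `hR9` read into
the 𝐑-leaf by the pin reading `hRpin`, and (UV₉) `hUV9`.  PROVISO-FREE: only `w.C` is read. [cite: Balaban1989LargeFieldII, Thm 1 p.355, (0.1) pp.355–356, p.387, p.391; Balaban1988Convergent, (0.2) and p.244, (2.18) p.257, Cor. 3 p.264] -/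
theorem b16_main_at_construction_repTower (hC : w.C = M.construction ρ)
    (hsucc : ∀ k, rep (k + 1) = Rstep k (Tstep k (rep k)))
    (hρ : ∀ k, ρ P k = eval k (rep k))
    (hS9 : ∀ k, k ≤ P.K → (M.Sect2Form P k ↔ (ρ P k = eval k (rep k) ∧ Laws k (rep k))))
    (hRpin : (∀ k, k < P.K → LawsT k (Tstep k (rep k)) → Laws (k + 1) (rep (k + 1))) → (w.up P).rOperation)
    (hR9 : ∀ k, k < P.K → ∀ r : Rep (k + 1), LawsT k r → Laws (k + 1) (Rstep k r)) {γ₁ : ℝ} (hγ : w.γ ≤ γ₁)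
    (hUV9 : (genFlow M.βfun P.g0).InInterval γ₁ P.K → ∀ k, k ≤ P.K → Laws k (rep k) → ∀ U : GaugeField (F.P P.K) k (SU N),
      M.χ P k U * Real.exp (-(1 / (genSeq M.βfun P.g0 k) ^ 2 * M.wilsonBG P k U)
          - w.em (genSeq M.βfun P.g0 k) * (Fintype.card (Site (F.P P.K) k) : ℝ)) ≤ eval k (rep k) U ∧
      eval k (rep k) U ≤ Real.exp (w.ep (genSeq M.βfun P.g0 k) * (Fintype.card (Site (F.P P.K) k) : ℝ))) :
    Dag.B16_main (leavesP w P) :=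
  b16_main_of_rOperation_of_uvSlot w P (rOperation_of_repTower w P rep Tstep Rstep Laws LawsT hsucc hRpin hR9)
    (uvSlot_at_construction F N M ρ w P rep Laws eval hC hρ (fun k hk h => ((hS9 k hk).1 h).2) hγ hUV9)

/-- The same with (R₉) asked only ALONG THE TOWER (`LawsT k (Tstep k (rep k)) → Laws (k+1) (rep (k+1))`). [cite: Balaban1989LargeFieldII, Thm 1 p.355, (0.1) pp.355–356, p.387, p.391] -/
theorem b16_main_at_construction_along (hC : w.C = M.construction ρ) (hρ : ∀ k, ρ P k = eval k (rep k))
    (hS9 : ∀ k, k ≤ P.K → (M.Sect2Form P k ↔ (ρ P k = eval k (rep k) ∧ Laws k (rep k))))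
    (hRpin : (∀ k, k < P.K → LawsT k (Tstep k (rep k)) → Laws (k + 1) (rep (k + 1))) → (w.up P).rOperation)
    (hRalong : ∀ k, k < P.K → LawsT k (Tstep k (rep k)) → Laws (k + 1) (rep (k + 1))) {γ₁ : ℝ} (hγ : w.γ ≤ γ₁)
    (hUV9 : (genFlow M.βfun P.g0).InInterval γ₁ P.K → ∀ k, k ≤ P.K → Laws k (rep k) → ∀ U : GaugeField (F.P P.K) k (SU N),
      M.χ P k U * Real.exp (-(1 / (genSeq M.βfun P.g0 k) ^ 2 * M.wilsonBG P k U)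
          - w.em (genSeq M.βfun P.g0 k) * (Fintype.card (Site (F.P P.K) k) : ℝ)) ≤ eval k (rep k) U ∧
      eval k (rep k) U ≤ Real.exp (w.ep (genSeq M.βfun P.g0 k) * (Fintype.card (Site (F.P P.K) k) : ℝ))) :
    Dag.B16_main (leavesP w P) :=
  b16_main_of_rOperation_of_uvSlot w P (hRpin hRalong)
    (uvSlot_at_construction F N M ρ w P rep Laws eval hC hρ (fun k hk h => ((hS9 k hk).1 h).2) hγ hUV9)

/-- The same from (R₉) and DOMINATED per-step (0.1) constants at `M.construction ρ P`, given `M.χ ≥ 0`. [cite: Balaban1989LargeFieldII, Thm 1 p.355, (0.1) pp.355–356, p.387] -/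
theorem b16_main_at_construction_dominated (hC : w.C = M.construction ρ)
    (hsucc : ∀ k, rep (k + 1) = Rstep k (Tstep k (rep k)))
    (hSL : ∀ k, k ≤ P.K → M.Sect2Form P k → Laws k (rep k))
    (hRpin : (∀ k, k < P.K → LawsT k (Tstep k (rep k)) → Laws (k + 1) (rep (k + 1))) → (w.up P).rOperation)
    (hR9 : ∀ k, k < P.K → ∀ r : Rep (k + 1), LawsT k r → Laws (k + 1) (Rstep k r)) {γ₁ : ℝ} (hγ : w.γ ≤ γ₁)
    (hχ : ∀ k, k ≤ P.K → ∀ U : GaugeField (F.P P.K) k (SU N), 0 ≤ M.χ P k U)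
    (hUVd : (genFlow M.βfun P.g0).InInterval γ₁ P.K → ∀ k, k ≤ P.K → Laws k (rep k) →
      ∃ Em Ep : ℝ, Em ≤ w.em (genSeq M.βfun P.g0 k) ∧ Ep ≤ w.ep (genSeq M.βfun P.g0 k) ∧
        ∀ U : GaugeField (F.P P.K) k (SU N), B16.UVIneq (M.construction ρ P) k U Em Ep) :
    Dag.B16_main (leavesP w P) :=
  b16_main_of_rOperation_of_uvSlot w P (rOperation_of_repTower w P rep Tstep Rstep Laws LawsT hsucc hRpin hR9)
    (uvSlot_at_construction_dominated F N M ρ w P rep Laws hC hSL hγ hχ hUVd)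

/-- **What N13's Cor.-3 product SAYS at a world on the construction** (A4 locator): under the Stage-₉ reading, N13 with its in-edge leaves, the interval hypothesis on
`]0, w.γ]` and law-abiding levels YIELDS (0.1) POINTWISE ON `eval rep_k` at the core's objects. [cite: Balaban1989LargeFieldII, (0.1) pp.355–356 (bookkeeping)] -/
theorem uvIneq_eval_of_b16_main_at_construction (hC : w.C = M.construction ρ) (hρ : ∀ k, ρ P k = eval k (rep k))
    (hS9 : ∀ k, k ≤ P.K → (M.Sect2Form P k ↔ (ρ P k = eval k (rep k) ∧ Laws k (rep k))))
    (h : Dag.B16_main (leavesP w P))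
    (h5 : (leavesP w P).b5) (h6 : (leavesP w P).b6) (h7 : (leavesP w P).b7) (h9 : (leavesP w P).b9) (h10 : (leavesP w P).b10)
    (h11 : (leavesP w P).b11) (h13 : (leavesP w P).b13) (hrb : (leavesP w P).rBasicStep)
    (hsf : (leavesP w P).smallCouplings → (leavesP w P).smallFieldInductive)
    (hsc : (genFlow M.βfun P.g0).InInterval w.γ P.K) (hlaws : ∀ k, k ≤ P.K → Laws k (rep k))
    (k : ℕ) (hk : k ≤ P.K) (U : GaugeField (F.P P.K) k (SU N)) :
    M.χ P k U * Real.exp (-(1 / (genSeq M.βfun P.g0 k) ^ 2 * M.wilsonBG P k U)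
        - w.em (genSeq M.βfun P.g0 k) * (Fintype.card (Site (F.P P.K) k) : ℝ)) ≤ eval k (rep k) U ∧
      eval k (rep k) U ≤ Real.exp (w.ep (genSeq M.βfun P.g0 k) * (Fintype.card (Site (F.P P.K) k) : ℝ)) := by
  have hdd : (leavesP w P).smallCouplings → (leavesP w P).densitiesDescribed := by
    intro _
    change ∀ k, k ≤ P.K → (w.C P).Sect2Form k
    rw [hC]
    exact fun k hk => (hS9 k hk).2 ⟨hρ k, hlaws k hk⟩
  have hsc' : (leavesP w P).smallCouplings := (smallCouplings_iff_genFlow_construction F N M ρ w P hC).2 hsc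
  have huv : (leavesP w P).uvBounds := (h h5 h6 h7 h9 h10 h11 h13 hrb hsf).2 hdd hsc'
  exact (uvBounds_iff_eval_construction F N M ρ w P rep eval hC hρ).1 huv k hk U

end Construction

/-! ## §1. N13 AT THE REPRESENTED TOWER OF RECORD: `ρ_k := Node00.rhoOfRecord9 …` (node00-def-T FILE 2), slots `slotsOfRecord`, steps OF RECORD -/

section OfRecord

variable (M : RGMachineCore F (SU N)) (w : WorldP) (P : B12.RunParams)
variable (ν : Stage7Numerics) (τ : TowerNumerics) (E : B12.RunParams → ℝ) (sw : StepWeightsOfRecord F N ν τ.M) (ppSel : PpSelOfRecord F ν τ.M)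
  (g : B12.RunParams → ℕ → ℝ)
variable
  (Laws : (k : ℕ) → TexpASlot F N ν τ.M P (g P) k → Prop)
  (LawsT : (k : ℕ) → TexpASlot F N ν τ.M P (g P) (k + 1) → Prop)

/-- **THE RECURSION OF RECORD IN MODULE-12 LETTERS** (`rfl`; node00-def-T's `slotsOfRecord_succ` ∘ `slotsTOfRecord_succ`): the slot family of record obeys `slot_{k+1} =
Rstep k (Tstep k slot_k)` with `Tstep k := tstepOfRecord … P (g P) k` (the T-step (3.1)∕(3.24) [III] of record) and `Rstep k := rstepSlotOfRecord … P (g P) (k+1)` (def-R's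
R-step [IV] (0.3) of record ON SLOTS). [cite: Balaban1988Convergent, (3.24) p.270; Balaban1989LargeFieldI, (0.3) p.176 (bookkeeping)] -/
theorem slotsOfRecord_recursion (k : ℕ) :
    slotsOfRecord F N ν τ E sw ppSel P (g P) (k + 1) =
      rstepSlotOfRecord F N ν τ ppSel P (g P) (k + 1)
        (tstepOfRecord F N ν τ.M sw P (g P) k (slotsOfRecord F N ν τ E sw ppSel P (g P) k)) := rfl

/-- **N13's CONCLUSION AT A WORLD ON A CORE'S CONSTRUCTION OVER THE DENSITIES OF RECORD IS (0.1) POINTWISE ON `rhoOfRecord9`**: for every `k ≤ K` and every gauge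
field `U`, `M.χ P k U · exp[−M.wilsonBG P k U ∕ g_k² − w.em(g_k)·|T₁^{(k)}|] ≤ ρ_k(U) ≤ exp[w.ep(g_k)·|T₁^{(k)}|]` with `ρ_k = rhoOfRecord9 F N ν τ E sw ppSel P (g P) k` —
the EXPLICIT represented density `Σ_s χ_k(s)(U)·slot_k(s)(U)` of [III] (2.18) ∕ [IV] (0.2) — and `g_k = genSeq M.βfun P.g0 k` (`rfl`).
[cite: Balaban1989LargeFieldII, (0.1) pp.355–356; Balaban1988Convergent, (2.18) p.257, Cor. 3 (2.50) p.264] -/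
theorem uvBounds_iff_rhoOfRecord9 (hC : w.C = M.construction fun p k => rhoOfRecord9 F N ν τ E sw ppSel p (g p) k) :
    (leavesP w P).uvBounds ↔
      ∀ k, k ≤ P.K → ∀ U : GaugeField (F.P P.K) k (SU N),
        M.χ P k U * Real.exp (-(1 / (genSeq M.βfun P.g0 k) ^ 2 * M.wilsonBG P k U)
            - w.em (genSeq M.βfun P.g0 k) * (Fintype.card (Site (F.P P.K) k) : ℝ)) ≤ rhoOfRecord9 F N ν τ E sw ppSel P (g P) k U ∧
        rhoOfRecord9 F N ν τ E sw ppSel P (g P) k U ≤ Real.exp (w.ep (genSeq M.βfun P.g0 k) * (Fintype.card (Site (F.P P.K) k) : ℝ)) :=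
  uvBounds_iff_construction F N M _ w P hC

/-- **N13 AT THE REPRESENTED TOWER OF RECORD** ([Balaban1989LargeFieldII] Thm 1 p. 355 + (0.1), Cor. 3 pp. 387 ∕ 391; NODE 00 Stage ₉, node00-def-T FILE 2): for a world
bound to a machine core's construction over the densities of record `ρ_k = rhoOfRecord9 … P (g P) k` (`hC`; at `Record9`: the core of record and `g P := genSeq β₉ P.g0`),
`Dag.B16_main (leavesP w P)` from — the Stage-₉ reading of the core's clause «`M.Sect2Form P k ↔ Laws k (slot_k)`» (`hS9`; the format-with-laws predicate of the CARRIED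
slot; NODE 00's `S218OfRecord₉`), the PIN READING `hRpin` of the world's 𝐑-leaf (law transport along the slot family of record ⇒ `(w.up P).rOperation`; NODE 00's pin of
the 𝐑-carriers), and N13's two OWN products at the objects of record: **(R₉)** `hR9` — for `k < K`, THE R-STEP OF RECORD `rstepSlotOfRecord … P (g P) (k+1)` carries every
level-`(k+1)` slot obeying `LawsT k` (the corresponding space of the T-image, [III] p. 262 ∕ p. 279) into a slot obeying `Laws (k+1)` (what [V] Thm 1 proves for 𝐑:
localisation §1, exponentiation, (1.80), (1.89), p. 391); **(UV₉)** `hUV9` — below the threshold `γ₁ ≥ w.γ`, (0.1) POINTWISE ON `rhoOfRecord9 … k` for law-abiding slots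
(p. 387).  NO recursion and NO density hypothesis: both are `rfl` at the tower of record.  PROVISO-FREE (only `w.C` is read).  HYPOTHESES displayed; count-neutral.
[cite: Balaban1989LargeFieldII, Thm 1 p.355, (0.1) pp.355–356, p.387, p.391; Balaban1988Convergent, p.244, (2.18) p.257, (3.24) p.270, Cor. 3 p.264; Balaban1989LargeFieldI, (0.3) p.176] -/
theorem b16_main_at_repTowerOfRecord (hC : w.C = M.construction fun p k => rhoOfRecord9 F N ν τ E sw ppSel p (g p) k)
    (hS9 : ∀ k, k ≤ P.K → (M.Sect2Form P k ↔ Laws k (slotsOfRecord F N ν τ E sw ppSel P (g P) k)))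
    (hRpin : (∀ k, k < P.K →
        LawsT k (tstepOfRecord F N ν τ.M sw P (g P) k (slotsOfRecord F N ν τ E sw ppSel P (g P) k)) →
          Laws (k + 1) (slotsOfRecord F N ν τ E sw ppSel P (g P) (k + 1))) → (w.up P).rOperation)
    (hR9 : ∀ k, k < P.K → ∀ f : TexpASlot F N ν τ.M P (g P) (k + 1),
      LawsT k f → Laws (k + 1) (rstepSlotOfRecord F N ν τ ppSel P (g P) (k + 1) f)) {γ₁ : ℝ} (hγ : w.γ ≤ γ₁)
    (hUV9 : (genFlow M.βfun P.g0).InInterval γ₁ P.K → ∀ k, k ≤ P.K → Laws k (slotsOfRecord F N ν τ E sw ppSel P (g P) k) →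
      ∀ U : GaugeField (F.P P.K) k (SU N),
        M.χ P k U * Real.exp (-(1 / (genSeq M.βfun P.g0 k) ^ 2 * M.wilsonBG P k U)
            - w.em (genSeq M.βfun P.g0 k) * (Fintype.card (Site (F.P P.K) k) : ℝ)) ≤ rhoOfRecord9 F N ν τ E sw ppSel P (g P) k U ∧
        rhoOfRecord9 F N ν τ E sw ppSel P (g P) k U ≤ Real.exp (w.ep (genSeq M.βfun P.g0 k) * (Fintype.card (Site (F.P P.K) k) : ℝ))) :
    Dag.B16_main (leavesP w P) :=
  b16_main_at_construction_repTower F N M _ w P (Rep := fun k => TexpASlot F N ν τ.M P (g P) k)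
    (slotsOfRecord F N ν τ E sw ppSel P (g P)) (fun k f => tstepOfRecord F N ν τ.M sw P (g P) k f)
    (fun k f => rstepSlotOfRecord F N ν τ ppSel P (g P) (k + 1) f) Laws LawsT
    (fun (j : ℕ) (f : TexpASlot F N ν τ.M P (g P) j) (V : GaugeField (F.P P.K) j (SU N)) =>
      ∑ s, chiSeqOfRecord F N ν τ.M (g P) P.K j s V * f s V)
    hC (fun _ => rfl) (fun _ => rfl) (fun k hk => ⟨fun h => ⟨rfl, (hS9 k hk).1 h⟩, fun h => (hS9 k hk).2 h.2⟩) hRpin hR9 hγ hUV9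

/-- **N13 AT THE REPRESENTED TOWER OF RECORD, (R₉) READ ALONG THE SLOT FAMILY** (`LawsT k (Tstep slot_k) → Laws (k+1) slot_{k+1}`; no R-step named) — the form NODE 00's 𝐑-leaf
pinned along the run's tower delivers by `Iff.rfl` (`VOfTower`, module 8 §2). [cite: Balaban1989LargeFieldII, Thm 1 p.355, (0.1) pp.355–356, p.387, p.391] -/
theorem b16_main_at_repTowerOfRecord_along (hC : w.C = M.construction fun p k => rhoOfRecord9 F N ν τ E sw ppSel p (g p) k)
    (hS9 : ∀ k, k ≤ P.K → (M.Sect2Form P k ↔ Laws k (slotsOfRecord F N ν τ E sw ppSel P (g P) k)))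
    (hRpin : (∀ k, k < P.K →
        LawsT k (tstepOfRecord F N ν τ.M sw P (g P) k (slotsOfRecord F N ν τ E sw ppSel P (g P) k)) →
          Laws (k + 1) (slotsOfRecord F N ν τ E sw ppSel P (g P) (k + 1))) → (w.up P).rOperation)
    (hRalong : ∀ k, k < P.K →
      LawsT k (tstepOfRecord F N ν τ.M sw P (g P) k (slotsOfRecord F N ν τ E sw ppSel P (g P) k)) →
        Laws (k + 1) (slotsOfRecord F N ν τ E sw ppSel P (g P) (k + 1))) {γ₁ : ℝ} (hγ : w.γ ≤ γ₁)
    (hUV9 : (genFlow M.βfun P.g0).InInterval γ₁ P.K → ∀ k, k ≤ P.K → Laws k (slotsOfRecord F N ν τ E sw ppSel P (g P) k) →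
      ∀ U : GaugeField (F.P P.K) k (SU N),
        M.χ P k U * Real.exp (-(1 / (genSeq M.βfun P.g0 k) ^ 2 * M.wilsonBG P k U)
            - w.em (genSeq M.βfun P.g0 k) * (Fintype.card (Site (F.P P.K) k) : ℝ)) ≤ rhoOfRecord9 F N ν τ E sw ppSel P (g P) k U ∧
        rhoOfRecord9 F N ν τ E sw ppSel P (g P) k U ≤ Real.exp (w.ep (genSeq M.βfun P.g0 k) * (Fintype.card (Site (F.P P.K) k) : ℝ))) :
    Dag.B16_main (leavesP w P) :=
  b16_main_at_construction_along F N M _ w P (Rep := fun k => TexpASlot F N ν τ.M P (g P) k)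
    (slotsOfRecord F N ν τ E sw ppSel P (g P)) (fun k f => tstepOfRecord F N ν τ.M sw P (g P) k f) Laws LawsT
    (fun (j : ℕ) (f : TexpASlot F N ν τ.M P (g P) j) (V : GaugeField (F.P P.K) j (SU N)) =>
      ∑ s, chiSeqOfRecord F N ν τ.M (g P) P.K j s V * f s V)
    hC (fun _ => rfl) (fun k hk => ⟨fun h => ⟨rfl, (hS9 k hk).1 h⟩, fun h => (hS9 k hk).2 h.2⟩) hRpin hRalong hγ hUV9

/-- **N13 AT THE REPRESENTED TOWER OF RECORD from (R₉) and DOMINATED per-step constants** `E₋ ≤ w.em(g_k)`, `E₊ ≤ w.ep(g_k)` with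
`B16.UVIneq (M.construction (rhoOfRecord9 …) P) k U E₋ E₊` pointwise — the currency the cell's Cor.-3 chain (`B16Cor3CurlyGas` ∕ `B16Cor3ActionBounds`) delivers at
`D := M.construction ρ₉ P` from a `Repr172` representation of `ρ_k` —, given `M.χ ≥ 0`. [cite: Balaban1989LargeFieldII, Thm 1 p.355, (0.1) pp.355–356, p.387] -/
theorem b16_main_at_repTowerOfRecord_dominated (hC : w.C = M.construction fun p k => rhoOfRecord9 F N ν τ E sw ppSel p (g p) k)
    (hSL : ∀ k, k ≤ P.K → M.Sect2Form P k → Laws k (slotsOfRecord F N ν τ E sw ppSel P (g P) k))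
    (hRpin : (∀ k, k < P.K →
        LawsT k (tstepOfRecord F N ν τ.M sw P (g P) k (slotsOfRecord F N ν τ E sw ppSel P (g P) k)) →
          Laws (k + 1) (slotsOfRecord F N ν τ E sw ppSel P (g P) (k + 1))) → (w.up P).rOperation)
    (hR9 : ∀ k, k < P.K → ∀ f : TexpASlot F N ν τ.M P (g P) (k + 1),
      LawsT k f → Laws (k + 1) (rstepSlotOfRecord F N ν τ ppSel P (g P) (k + 1) f)) {γ₁ : ℝ} (hγ : w.γ ≤ γ₁)
    (hχ : ∀ k, k ≤ P.K → ∀ U : GaugeField (F.P P.K) k (SU N), 0 ≤ M.χ P k U)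
    (hUVd : (genFlow M.βfun P.g0).InInterval γ₁ P.K → ∀ k, k ≤ P.K → Laws k (slotsOfRecord F N ν τ E sw ppSel P (g P) k) →
      ∃ Em Ep : ℝ, Em ≤ w.em (genSeq M.βfun P.g0 k) ∧ Ep ≤ w.ep (genSeq M.βfun P.g0 k) ∧
        ∀ U : GaugeField (F.P P.K) k (SU N),
          B16.UVIneq (M.construction (fun p k => rhoOfRecord9 F N ν τ E sw ppSel p (g p) k) P) k U Em Ep) :
    Dag.B16_main (leavesP w P) :=
  b16_main_at_construction_dominated F N M _ w P (Rep := fun k => TexpASlot F N ν τ.M P (g P) k)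
    (slotsOfRecord F N ν τ E sw ppSel P (g P)) (fun k f => tstepOfRecord F N ν τ.M sw P (g P) k f)
    (fun k f => rstepSlotOfRecord F N ν τ ppSel P (g P) (k + 1) f) Laws LawsT
    hC (fun _ => rfl) hSL hRpin hR9 hγ hχ hUVd

/-- **What N13's Cor.-3 product SAYS at the represented tower of record** (A4 locator): N13 at `(w, P)` with its in-edge leaves, the interval hypothesis on `]0, w.γ]` and
law-abiding slots `∀ k ≤ K, Laws k (slot_k)` YIELDS (0.1) POINTWISE ON THE DENSITIES OF RECORD `rhoOfRecord9 … k U`, every `k ≤ K`, every configuration `U`.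
[cite: Balaban1989LargeFieldII, (0.1) pp.355–356 (bookkeeping); Balaban1988Convergent, (2.18) p.257] -/
theorem uvIneq_rhoOfRecord9_of_b16_main (hC : w.C = M.construction fun p k => rhoOfRecord9 F N ν τ E sw ppSel p (g p) k)
    (hS9 : ∀ k, k ≤ P.K → (M.Sect2Form P k ↔ Laws k (slotsOfRecord F N ν τ E sw ppSel P (g P) k)))
    (h : Dag.B16_main (leavesP w P))
    (h5 : (leavesP w P).b5) (h6 : (leavesP w P).b6) (h7 : (leavesP w P).b7) (h9 : (leavesP w P).b9) (h10 : (leavesP w P).b10)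
    (h11 : (leavesP w P).b11) (h13 : (leavesP w P).b13) (hrb : (leavesP w P).rBasicStep)
    (hsf : (leavesP w P).smallCouplings → (leavesP w P).smallFieldInductive)
    (hsc : (genFlow M.βfun P.g0).InInterval w.γ P.K) (hlaws : ∀ k, k ≤ P.K → Laws k (slotsOfRecord F N ν τ E sw ppSel P (g P) k))
    (k : ℕ) (hk : k ≤ P.K) (U : GaugeField (F.P P.K) k (SU N)) :
    M.χ P k U * Real.exp (-(1 / (genSeq M.βfun P.g0 k) ^ 2 * M.wilsonBG P k U)
        - w.em (genSeq M.βfun P.g0 k) * (Fintype.card (Site (F.P P.K) k) : ℝ)) ≤ rhoOfRecord9 F N ν τ E sw ppSel P (g P) k U ∧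
      rhoOfRecord9 F N ν τ E sw ppSel P (g P) k U ≤ Real.exp (w.ep (genSeq M.βfun P.g0 k) * (Fintype.card (Site (F.P P.K) k) : ℝ)) :=
  uvIneq_eval_of_b16_main_at_construction F N M _ w P (Rep := fun k => TexpASlot F N ν τ.M P (g P) k)
    (slotsOfRecord F N ν τ E sw ppSel P (g P)) Laws
    (fun (j : ℕ) (f : TexpASlot F N ν τ.M P (g P) j) (V : GaugeField (F.P P.K) j (SU N)) =>
      ∑ s, chiSeqOfRecord F N ν τ.M (g P) P.K j s V * f s V)
    hC (fun _ => rfl) (fun k hk => ⟨fun h => ⟨rfl, (hS9 k hk).1 h⟩, fun h => (hS9 k hk).2 h.2⟩)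
    h h5 h6 h7 h9 h10 h11 h13 hrb hsf hsc hlaws k hk U

end OfRecord


/-! ## §2 (v1.1). N13 over ANY record predicate of NODE 00's Stage-₉ SHAPE (node00-def-T [INTENT-3] §6): the `Record9` corollary as a `rfl` instantiation -/

section RecordShape

variable {F N}

/-- **N13 AT EVERY RUN OF EVERY WORLD OF ANY RECORD PREDICATE OF THE STAGE-₉ SHAPE** (node00-def-T [INTENT-3] `Record9` §6, seat dag-n11-a's sibling
`B14NodeKnitRecord9.b14_main_forall_of_recordShape`): parameters `Θ` (the stage's parameter type), `Prov` (its displayed provisos), `Adm` (admissibility), the θ-keyed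
residual data `νOf, τOf, EOf, swOf, ppOf, gOf`, the machine core `core θ` and the datum `datum θ h` WITH `(datum θ h).C = (core θ).construction (ρ₉ θ)` where
`ρ₉ θ p k := rhoOfRecord9 … p (gOf θ p) k` (`hdatum` — at `Record9`: `rfl` by `datumOfTower_C` + `towerOfRecord9_ρ`), and a record predicate `Rec` whose pairs are bound to
such a datum (`hRec` — the predicate's first conjuncts).  GIVEN per admissible `θ`, provisos `h`, bound world `w` and run `P` the Stage-₉ reading «`(core θ).Sect2Form P k
↔ Laws θ P k (slot_k)`», the pin reading of the world's 𝐑-leaf, (R₉) for the R-step of record and (UV₉) on `rhoOfRecord9` below `w.γ` (`slots`), N13 holds at every run of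
every `Rec`-world — §1 `b16_main_at_repTowerOfRecord` BY NAME.  The `Record9` instantiation: `Θ := Stage9Params F N`, `Prov := Stage9Params.Provisos`, `Adm :=
Stage9Params.Admissible`, `core := coreOfRecord₉`, `datum := datumOfRecord₉`, `gOf := gOfRecord₉`, `Rec := IsRecordOfRecord₉C F N`, `hdatum := fun _ _ => rfl`.
[cite: Balaban1989LargeFieldII, Thm 1 p.355, (0.1) pp.355–356, p.387, p.391; Balaban1988Convergent, p.244, (2.18) p.257, Cor. 3 p.264; Balaban1989LargeFieldI, (0.3) p.176] -/
theorem b16_main_forall_of_recordShape {Θ : Type*} (Prov : Θ → Prop) (Adm : Θ → Prop)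
    (νOf : Θ → Stage7Numerics) (τOf : Θ → TowerNumerics) (EOf : Θ → B12.RunParams → ℝ)
    (swOf : (θ : Θ) → StepWeightsOfRecord F N (νOf θ) (τOf θ).M) (ppOf : (θ : Θ) → PpSelOfRecord F (νOf θ) (τOf θ).M)
    (gOf : Θ → B12.RunParams → ℕ → ℝ) (core : Θ → RGMachineCore F (SU N)) (datum : (θ : Θ) → Prov θ → FiniteEpsData F (SU N))
    (hdatum : ∀ (θ : Θ) (h : Prov θ),
      (datum θ h).C = (core θ).construction fun p k => rhoOfRecord9 F N (νOf θ) (τOf θ) (EOf θ) (swOf θ) (ppOf θ) p (gOf θ p) k)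
    (Rec : FiniteEpsData F (SU N) → WorldP → Prop)
    (hRec : ∀ (D : FiniteEpsData F (SU N)) (w : WorldP), Rec D w → ∃ (θ : Θ) (h : Prov θ), Adm θ ∧ D = datum θ h ∧ w.C = D.C)
    (Laws : (θ : Θ) → (P : B12.RunParams) → (k : ℕ) → TexpASlot F N (νOf θ) (τOf θ).M P (gOf θ P) k → Prop)
    (LawsT : (θ : Θ) → (P : B12.RunParams) → (k : ℕ) → TexpASlot F N (νOf θ) (τOf θ).M P (gOf θ P) (k + 1) → Prop)
    (slots : ∀ θ : Θ, Adm θ → ∀ (h : Prov θ) (w : WorldP), w.C = (datum θ h).C → ∀ P : B12.RunParams,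
      (∀ k, k ≤ P.K → ((core θ).Sect2Form P k ↔
        Laws θ P k (slotsOfRecord F N (νOf θ) (τOf θ) (EOf θ) (swOf θ) (ppOf θ) P (gOf θ P) k))) ∧
      ((∀ k, k < P.K →
          LawsT θ P k (tstepOfRecord F N (νOf θ) (τOf θ).M (swOf θ) P (gOf θ P) k
            (slotsOfRecord F N (νOf θ) (τOf θ) (EOf θ) (swOf θ) (ppOf θ) P (gOf θ P) k)) →
          Laws θ P (k + 1) (slotsOfRecord F N (νOf θ) (τOf θ) (EOf θ) (swOf θ) (ppOf θ) P (gOf θ P) (k + 1))) →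
        (w.up P).rOperation) ∧
      (∀ k, k < P.K → ∀ f : TexpASlot F N (νOf θ) (τOf θ).M P (gOf θ P) (k + 1),
        LawsT θ P k f → Laws θ P (k + 1) (rstepSlotOfRecord F N (νOf θ) (τOf θ) (ppOf θ) P (gOf θ P) (k + 1) f)) ∧
      ((genFlow (core θ).βfun P.g0).InInterval w.γ P.K → ∀ k, k ≤ P.K →
        Laws θ P k (slotsOfRecord F N (νOf θ) (τOf θ) (EOf θ) (swOf θ) (ppOf θ) P (gOf θ P) k) →
          ∀ U : GaugeField (F.P P.K) k (SU N),
            (core θ).χ P k U * Real.exp (-(1 / (genSeq (core θ).βfun P.g0 k) ^ 2 * (core θ).wilsonBG P k U)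
                - w.em (genSeq (core θ).βfun P.g0 k) * (Fintype.card (Site (F.P P.K) k) : ℝ)) ≤
              rhoOfRecord9 F N (νOf θ) (τOf θ) (EOf θ) (swOf θ) (ppOf θ) P (gOf θ P) k U ∧
            rhoOfRecord9 F N (νOf θ) (τOf θ) (EOf θ) (swOf θ) (ppOf θ) P (gOf θ P) k U ≤
              Real.exp (w.ep (genSeq (core θ).βfun P.g0 k) * (Fintype.card (Site (F.P P.K) k) : ℝ)))) :
    ∀ (D : FiniteEpsData F (SU N)) (w : WorldP), Rec D w → ∀ P : B12.RunParams, Dag.B16_main (leavesP w P) := by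
  intro D w hw P
  obtain ⟨θ, h, hθ, hD, hC⟩ := hRec D w hw
  have hC' : w.C = (core θ).construction fun p k => rhoOfRecord9 F N (νOf θ) (τOf θ) (EOf θ) (swOf θ) (ppOf θ) p (gOf θ p) k := by
    rw [hC, hD, hdatum]
  obtain ⟨hS9, hRpin, hR9, hUV9⟩ := slots θ hθ h w (by rw [hC, hD]) P
  exact b16_main_at_repTowerOfRecord F N (core θ) w P (νOf θ) (τOf θ) (EOf θ) (swOf θ) (ppOf θ) (gOf θ) (Laws θ P) (LawsT θ P)
    hC' hS9 hRpin hR9 le_rfl hUV9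

/-- The same with (R₉) READ ALONG THE SLOT FAMILY per world (the form NODE 00's pinned 𝐑-leaf delivers by `Iff.rfl`) — §1 `b16_main_at_repTowerOfRecord_along` BY NAME.
[cite: Balaban1989LargeFieldII, Thm 1 p.355, (0.1) pp.355–356, p.387, p.391] -/
theorem b16_main_forall_of_recordShape_along {Θ : Type*} (Prov : Θ → Prop) (Adm : Θ → Prop)
    (νOf : Θ → Stage7Numerics) (τOf : Θ → TowerNumerics) (EOf : Θ → B12.RunParams → ℝ)
    (swOf : (θ : Θ) → StepWeightsOfRecord F N (νOf θ) (τOf θ).M) (ppOf : (θ : Θ) → PpSelOfRecord F (νOf θ) (τOf θ).M)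
    (gOf : Θ → B12.RunParams → ℕ → ℝ) (core : Θ → RGMachineCore F (SU N)) (datum : (θ : Θ) → Prov θ → FiniteEpsData F (SU N))
    (hdatum : ∀ (θ : Θ) (h : Prov θ),
      (datum θ h).C = (core θ).construction fun p k => rhoOfRecord9 F N (νOf θ) (τOf θ) (EOf θ) (swOf θ) (ppOf θ) p (gOf θ p) k)
    (Rec : FiniteEpsData F (SU N) → WorldP → Prop)
    (hRec : ∀ (D : FiniteEpsData F (SU N)) (w : WorldP), Rec D w → ∃ (θ : Θ) (h : Prov θ), Adm θ ∧ D = datum θ h ∧ w.C = D.C)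
    (Laws : (θ : Θ) → (P : B12.RunParams) → (k : ℕ) → TexpASlot F N (νOf θ) (τOf θ).M P (gOf θ P) k → Prop)
    (LawsT : (θ : Θ) → (P : B12.RunParams) → (k : ℕ) → TexpASlot F N (νOf θ) (τOf θ).M P (gOf θ P) (k + 1) → Prop)
    (slots : ∀ θ : Θ, Adm θ → ∀ (h : Prov θ) (w : WorldP), w.C = (datum θ h).C → ∀ P : B12.RunParams,
      (∀ k, k ≤ P.K → ((core θ).Sect2Form P k ↔
        Laws θ P k (slotsOfRecord F N (νOf θ) (τOf θ) (EOf θ) (swOf θ) (ppOf θ) P (gOf θ P) k))) ∧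
      ((∀ k, k < P.K →
          LawsT θ P k (tstepOfRecord F N (νOf θ) (τOf θ).M (swOf θ) P (gOf θ P) k
            (slotsOfRecord F N (νOf θ) (τOf θ) (EOf θ) (swOf θ) (ppOf θ) P (gOf θ P) k)) →
          Laws θ P (k + 1) (slotsOfRecord F N (νOf θ) (τOf θ) (EOf θ) (swOf θ) (ppOf θ) P (gOf θ P) (k + 1))) →
        (w.up P).rOperation) ∧
      (∀ k, k < P.K →
        LawsT θ P k (tstepOfRecord F N (νOf θ) (τOf θ).M (swOf θ) P (gOf θ P) k
            (slotsOfRecord F N (νOf θ) (τOf θ) (EOf θ) (swOf θ) (ppOf θ) P (gOf θ P) k)) →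
          Laws θ P (k + 1) (slotsOfRecord F N (νOf θ) (τOf θ) (EOf θ) (swOf θ) (ppOf θ) P (gOf θ P) (k + 1))) ∧
      ((genFlow (core θ).βfun P.g0).InInterval w.γ P.K → ∀ k, k ≤ P.K →
        Laws θ P k (slotsOfRecord F N (νOf θ) (τOf θ) (EOf θ) (swOf θ) (ppOf θ) P (gOf θ P) k) →
          ∀ U : GaugeField (F.P P.K) k (SU N),
            (core θ).χ P k U * Real.exp (-(1 / (genSeq (core θ).βfun P.g0 k) ^ 2 * (core θ).wilsonBG P k U)
                - w.em (genSeq (core θ).βfun P.g0 k) * (Fintype.card (Site (F.P P.K) k) : ℝ)) ≤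
              rhoOfRecord9 F N (νOf θ) (τOf θ) (EOf θ) (swOf θ) (ppOf θ) P (gOf θ P) k U ∧
            rhoOfRecord9 F N (νOf θ) (τOf θ) (EOf θ) (swOf θ) (ppOf θ) P (gOf θ P) k U ≤
              Real.exp (w.ep (genSeq (core θ).βfun P.g0 k) * (Fintype.card (Site (F.P P.K) k) : ℝ)))) :
    ∀ (D : FiniteEpsData F (SU N)) (w : WorldP), Rec D w → ∀ P : B12.RunParams, Dag.B16_main (leavesP w P) := by
  intro D w hw P
  obtain ⟨θ, h, hθ, hD, hC⟩ := hRec D w hw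
  have hC' : w.C = (core θ).construction fun p k => rhoOfRecord9 F N (νOf θ) (τOf θ) (EOf θ) (swOf θ) (ppOf θ) p (gOf θ p) k := by
    rw [hC, hD, hdatum]
  obtain ⟨hS9, hRpin, hRalong, hUV9⟩ := slots θ hθ h w (by rw [hC, hD]) P
  exact b16_main_at_repTowerOfRecord_along F N (core θ) w P (νOf θ) (τOf θ) (EOf θ) (swOf θ) (ppOf θ) (gOf θ) (Laws θ P) (LawsT θ P)
    hC' hS9 hRpin hRalong le_rfl hUV9

end RecordShape

end Literature.MathematicalPhysics.QuantumFieldTheory.Balaban1983to89.B16NodeKnitRepTowerOfRecord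

end
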